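import Summits.QuantumFields.BalabanUV.Beta.SymmetrisedContourOrder

/-!
# `BalabanUV.Beta.SymmetrisedContourCount` — binder row D1, RULING R-D1-g25-1 step S1c (part 2 of I-d1ref34-2 (i)): THE WEIGHT IDENTITY
# «uniform mean over the d! axis orders = [Balaban1987RG1]'s mean over the contour family G(y,x)» —
# `(Σ_σ F (combOrder σ y x)) · m! = d! · Σ_{l ∈ orderings y x} F l`, `m` = number of moving axes, `orderings y x` = the m! linear orders of them

HONEST FRAMING (cell contract, verbatim): «discharging `BetaPertH` makes Bałaban's UV stability UNCONDITIONAL — a real constructive-QFT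
result; it is NOT the continuum limit and NOT the Clay problem.»  THIS MODULE DISCHARGES NOTHING of `BetaPertH` ∕ row D1: [folklore] counting
on the symmetric group.  0 sorry, 0 `def … : Prop` carrying a citation, nothing cited as a fact; quotations are OBJECT LOCATORS.

WHAT.  [Balaban1987RG1] p.252–253: `G(y,x)` = «the family of contours generated by all such permutations» of the axes with `n_μ ≠ 0`, averaged in (0.4)
with weight `1∕|G(c₋,x)|`.  Part 1 (`SymmetrisedContourOrder`) proved that the σ-comb depends on `σ ∈ S_d` only through `combOrder σ y x`, the induced
order of the moving axes.  Here: the group `stabSet y x` of permutations fixing every idle axis (≃ `Perm` of the moving axes, cardinality `m!`) acts on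
the orders by `σ ↦ τσ` with `combOrder (τσ) = (combOrder σ).map τ`; for a fixed `σ` the map `τ ↦ (combOrder σ).map τ` is a bijection of `stabSet` onto
`orderings y x` (the `m!` nodup lists enumerating the moving axes); averaging over the action gives the WEIGHT IDENTITY `sum_combOrder_mul_card` and its
corollary for S1's potential, **`symAxial_mul_card : symAxial A y x · m! = d! · Σ_{l ∈ orderings y x} (stairFrom l A y x).sum`** — the unnormalised S_d-sum
of S1 IS `d!∕m!` times the sum over B12's contour family, i.e. `(1∕d!)·symAxial = |G(y,x)|⁻¹ Σ_{Γ∈G(y,x)} A(Γ)` with `|G(y,x)| = m!` (`card_orderings`).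
NOT D1, NOT BetaPertH, NOT continuum, NOT Clay.
HONEST DEPENDENCY (verbatim): «continuum YM on T⁴ ⇐ BetaPertH ∧ nine spine estimates (0/9 proved); BetaPertH ⇐ (D1) ∧ (D4) ∧ CAP+tail;
G-an2-4 gates asym, D1 and NE2/3/4.»  ABSOLUTE RULE (cell, verbatim): «No internally-minted statement may enter as a cited fact. Every
hypothesis is either kernel-proved in this package or a verbatim quotation of a PUBLISHED theorem with page reference.»
Unit `b2b-balaban-beta-an2` gen 25 (row-D1 owner), 2026-08-21.
-/

namespace Summit.QuantumFields.BalabanUV.Beta.SymmetrisedContourCount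

noncomputable section

open Finset
open scoped BigOperators Nat
open Literature.MathematicalPhysics.QuantumFieldTheory.Balaban1983to89.Beta
open AffineAveraging (Form1 Site)
open Summit.QuantumFields.BalabanUV.Beta.SymmetrisedAxialPotential
open Summit.QuantumFields.BalabanUV.Beta.SymmetrisedLoopWords
open Summit.QuantumFields.BalabanUV.Beta.SymmetrisedContourOrder

variable {d : ℕ}

/-! ## §1 The descending axis list: membership and no duplicates -/

/-- [folklore] Members of `axesBelow m` are the axes with value `< m`. -/
theorem mem_axesBelow (i : Fin d) : ∀ (m : ℕ) (h : m ≤ d), i ∈ axesBelow m h ↔ (i : ℕ) < m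
  | 0, _ => by simp [axesBelow]
  | m + 1, h => by
    rw [axesBelow, List.mem_cons, mem_axesBelow i m (Nat.le_of_succ_le h), Fin.ext_iff]
    show (i : ℕ) = m ∨ (i : ℕ) < m ↔ (i : ℕ) < m + 1
    omega

/-- [folklore] Every axis is in `axesDesc d`. -/
theorem mem_axesDesc (i : Fin d) : i ∈ axesDesc d := (mem_axesBelow i d le_rfl).2 i.isLt

/-- [folklore] `axesBelow m` has no duplicates. -/
theorem nodup_axesBelow : ∀ (m : ℕ) (h : m ≤ d), (axesBelow m h).Nodup
  | 0, _ => by simp [axesBelow]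
  | m + 1, h => by
    rw [axesBelow, List.nodup_cons, mem_axesBelow]
    exact ⟨by simp, nodup_axesBelow m (Nat.le_of_succ_le h)⟩

/-- [folklore] `axesDesc d` has no duplicates. -/
theorem nodup_axesDesc : (axesDesc d).Nodup := nodup_axesBelow d le_rfl

/-! ## §2 The induced order enumerates the moving axes without repetition -/

/-- [our object] The set of MOVING axes of the pair `(y, x)`. -/
def movingAxes (y x : Site d) : Finset (Fin d) := univ.filter fun i => x i ≠ y i

/-- [folklore] Membership in `movingAxes`. -/
@[simp] theorem mem_movingAxes {y x : Site d} {i : Fin d} : i ∈ movingAxes y x ↔ x i ≠ y i := by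
  simp [movingAxes]

/-- [folklore] `combOrder σ y x` lists exactly the moving axes. -/
theorem mem_combOrder {σ : Equiv.Perm (Fin d)} {y x : Site d} {i : Fin d} : i ∈ combOrder σ y x ↔ x i ≠ y i := by
  simp only [combOrder, List.mem_filter, List.mem_map, decide_eq_true_eq, and_iff_right_iff_imp]
  exact fun _ => ⟨σ.symm i, mem_axesDesc _, σ.apply_symm_apply i⟩

/-- [folklore] `combOrder σ y x` has no duplicates. -/
theorem nodup_combOrder (σ : Equiv.Perm (Fin d)) (y x : Site d) : (combOrder σ y x).Nodup :=
  ((nodup_axesDesc).map σ.injective).filter _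

/-- [folklore] Any two induced orders are permutations of each other (same members, no duplicates). -/
theorem perm_combOrder (σ σ' : Equiv.Perm (Fin d)) (y x : Site d) : (combOrder σ y x).Perm (combOrder σ' y x) :=
  (List.perm_ext_iff_of_nodup (nodup_combOrder σ y x) (nodup_combOrder σ' y x)).2 fun i => by rw [mem_combOrder, mem_combOrder]

/-- [folklore] The induced order has `m` = number of moving axes entries. -/
theorem length_combOrder (σ : Equiv.Perm (Fin d)) (y x : Site d) : (combOrder σ y x).length = (movingAxes y x).card := by
  rw [← List.toFinset_card_of_nodup (nodup_combOrder σ y x)]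
  congr 1
  ext i
  rw [List.mem_toFinset, mem_combOrder, mem_movingAxes]

/-! ## §3 The stabiliser of the idle axes acts on the induced orders -/

/-- [folklore] [our object] `τ` FIXES EVERY IDLE AXIS of the pair `(y, x)`. -/
def FixesIdle (y x : Site d) (τ : Equiv.Perm (Fin d)) : Prop := ∀ i, x i = y i → τ i = i

/-- [folklore] A permutation fixing the idle axes maps moving axes to moving axes (and idle to idle). -/
theorem moving_iff_of_fixesIdle {y x : Site d} {τ : Equiv.Perm (Fin d)} (hτ : FixesIdle y x τ) (i : Fin d) :
    x (τ i) ≠ y (τ i) ↔ x i ≠ y i := by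
  constructor
  · intro h hi
    exact h (by rw [hτ i hi]; exact hi)
  · intro h hτi
    have h1 : τ (τ i) = τ i := hτ (τ i) hτi
    have h2 : τ i = i := τ.injective h1
    rw [h2] at hτi
    exact h hτi

/-- [folklore] **THE ACTION ON INDUCED ORDERS**: `combOrder (τσ) y x = (combOrder σ y x).map τ` for `τ` fixing the idle axes. -/
theorem combOrder_mul {y x : Site d} {τ : Equiv.Perm (Fin d)} (hτ : FixesIdle y x τ) (σ : Equiv.Perm (Fin d)) :
    combOrder (τ * σ) y x = (combOrder σ y x).map ⇑τ := by
  have hmap : (axesDesc d).map ⇑(τ * σ) = ((axesDesc d).map σ).map τ := by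
    rw [List.map_map]; rfl
  rw [combOrder, combOrder, hmap, List.filter_map]
  congr 1
  refine List.filter_congr fun i _ => ?_
  simp only [Function.comp_apply, decide_eq_decide]
  exact moving_iff_of_fixesIdle hτ i

/-- [folklore] `FixesIdle` is decidable (finitely many axes). -/
instance instDecidableFixesIdle (y x : Site d) : DecidablePred (FixesIdle y x) := fun τ => by
  unfold FixesIdle; infer_instance

/-- [folklore] [our object] The stabiliser of the idle axes, as a finite set of permutations. -/
def stabSet (y x : Site d) : Finset (Equiv.Perm (Fin d)) := univ.filter fun τ => FixesIdle y x τ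

/-- [folklore] Membership in `stabSet`. -/
@[simp] theorem mem_stabSet {y x : Site d} {τ : Equiv.Perm (Fin d)} : τ ∈ stabSet y x ↔ FixesIdle y x τ := by
  simp [stabSet]

/-- [folklore] **`|stabSet y x| = m!`**: the stabiliser of the idle axes is the permutation group of the moving axes
(`Equiv.Perm.subtypeEquivSubtypePerm`). -/
theorem card_stabSet (y x : Site d) : (stabSet y x).card = (movingAxes y x).card ! := by
  classical
  have e := Equiv.Perm.subtypeEquivSubtypePerm (fun i : Fin d => x i ≠ y i)
  have h1 : (stabSet y x).card = Fintype.card {f : Equiv.Perm (Fin d) // ∀ a, ¬ (x a ≠ y a) → f a = a} := by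
    rw [Fintype.card_subtype]
    congr 1
    ext τ
    simp only [mem_stabSet, FixesIdle, Finset.mem_filter, Finset.mem_univ, true_and, not_not]
  rw [h1, ← Fintype.card_congr e, Fintype.card_perm, Fintype.card_subtype]
  rfl

/-! ## §4 For a fixed order, `τ ↦ (combOrder σ).map τ` is a bijection of the stabiliser onto the orderings of the moving axes -/

/-- [our object] THE ORDERINGS of the moving axes: the `m!` duplicate-free lists enumerating `movingAxes y x` (as the permutations of one of them). -/
def orderings (y x : Site d) : Finset (List (Fin d)) := (combOrder 1 y x).permutations.toFinset

/-- [folklore] Every induced order has the same finite set of permutations. -/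
theorem permutations_toFinset_combOrder (σ : Equiv.Perm (Fin d)) (y x : Site d) :
    (combOrder σ y x).permutations.toFinset = orderings y x :=
  List.toFinset_eq_of_perm _ _ ((perm_combOrder σ 1 y x).permutations)

/-- [folklore] Membership: `l ∈ orderings y x` iff `l` is a duplicate-free enumeration of the moving axes. -/
theorem mem_orderings {y x : Site d} {l : List (Fin d)} : l ∈ orderings y x ↔ l.Nodup ∧ ∀ i, i ∈ l ↔ x i ≠ y i := by
  rw [orderings, List.mem_toFinset, List.mem_permutations]
  constructor
  · intro h
    exact ⟨h.nodup_iff.2 (nodup_combOrder 1 y x), fun i => by rw [h.mem_iff, mem_combOrder]⟩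
  · rintro ⟨hn, hm⟩
    exact (List.perm_ext_iff_of_nodup hn (nodup_combOrder 1 y x)).2 fun i => by rw [hm, mem_combOrder]

/-- [folklore] **`|orderings y x| = m!`** (= `|G(y,x)|` of [Balaban1987RG1] p.252). -/
theorem card_orderings (y x : Site d) : (orderings y x).card = (movingAxes y x).card ! := by
  rw [orderings, List.toFinset_card_of_nodup (List.nodup_permutations _ (nodup_combOrder 1 y x)), List.length_permutations,
    length_combOrder]

/-- [folklore] The image of the stabiliser lands in the orderings. -/
theorem map_mem_orderings {y x : Site d} {τ : Equiv.Perm (Fin d)} (hτ : FixesIdle y x τ) (σ : Equiv.Perm (Fin d)) :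
    (combOrder σ y x).map ⇑τ ∈ orderings y x := by
  rw [← combOrder_mul hτ σ, ← permutations_toFinset_combOrder (τ * σ) y x, List.mem_toFinset, List.mem_permutations]

/-- [folklore] The action on a fixed induced order is injective on the stabiliser. -/
theorem map_injOn (σ : Equiv.Perm (Fin d)) (y x : Site d) :
    Set.InjOn (fun τ : Equiv.Perm (Fin d) => (combOrder σ y x).map ⇑τ) (stabSet y x) := by
  intro τ hτ τ' hτ' h
  rw [Finset.mem_coe, mem_stabSet] at hτ hτ'
  have h' : ∀ i ∈ combOrder σ y x, τ i = τ' i := List.map_eq_map_iff.1 h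
  ext i
  by_cases hi : x i ≠ y i
  · exact congrArg Fin.val (h' i (mem_combOrder.2 hi))
  · rw [not_not] at hi
    rw [hτ i hi, hτ' i hi]

/-- [folklore] **BIJECTION**: the image of the stabiliser under `τ ↦ (combOrder σ).map τ` IS the set of orderings (injective + both of cardinality `m!`). -/
theorem image_stabSet (σ : Equiv.Perm (Fin d)) (y x : Site d) :
    (stabSet y x).image (fun τ : Equiv.Perm (Fin d) => (combOrder σ y x).map ⇑τ) = orderings y x := by
  apply Finset.eq_of_subset_of_card_le
  · intro l hl
    obtain ⟨τ, hτ, rfl⟩ := Finset.mem_image.1 hl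
    exact map_mem_orderings (mem_stabSet.1 hτ) σ
  · rw [Finset.card_image_of_injOn (map_injOn σ y x), card_stabSet, card_orderings]

/-! ## §5 The weight identity -/

/-- [folklore] Summing over the stabiliser's action on one induced order = summing over all orderings. -/
theorem sum_stabSet_map (F : List (Fin d) → ℝ) (σ : Equiv.Perm (Fin d)) (y x : Site d) :
    ∑ τ ∈ stabSet y x, F ((combOrder σ y x).map ⇑τ) = ∑ l ∈ orderings y x, F l := by
  rw [← image_stabSet σ y x, Finset.sum_image (map_injOn σ y x)]

/-- [folklore] The σ-sum is invariant under left translation. -/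
theorem sum_combOrder_mul_left (F : List (Fin d) → ℝ) (τ : Equiv.Perm (Fin d)) (y x : Site d) :
    ∑ σ : Equiv.Perm (Fin d), F (combOrder (τ * σ) y x) = ∑ σ : Equiv.Perm (Fin d), F (combOrder σ y x) :=
  Fintype.sum_bijective (fun σ => τ * σ) (Group.mulLeft_bijective τ) _ _ fun _ => rfl

/-- [folklore] **THE WEIGHT IDENTITY**: `(Σ_{σ ∈ S_d} F (combOrder σ y x)) · m! = d! · Σ_{l ∈ orderings y x} F l` — the uniform mean over the full axis
orders equals the uniform mean over the `m!` orders of the moving axes (= B12's `|G(y,x)|⁻¹ Σ_{Γ ∈ G(y,x)}`), for ANY function of the induced order. -/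
theorem sum_combOrder_mul_card (F : List (Fin d) → ℝ) (y x : Site d) :
    (∑ σ : Equiv.Perm (Fin d), F (combOrder σ y x)) * ((movingAxes y x).card ! : ℝ)
      = (d ! : ℝ) * ∑ l ∈ orderings y x, F l := by
  have h1 : (∑ σ : Equiv.Perm (Fin d), F (combOrder σ y x)) * ((movingAxes y x).card ! : ℝ)
      = ∑ τ ∈ stabSet y x, ∑ σ : Equiv.Perm (Fin d), F (combOrder (τ * σ) y x) := by
    simp only [sum_combOrder_mul_left, Finset.sum_const, card_stabSet, nsmul_eq_mul]
    ring
  rw [h1, Finset.sum_comm]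
  have h2 : ∀ σ : Equiv.Perm (Fin d), ∑ τ ∈ stabSet y x, F (combOrder (τ * σ) y x) = ∑ l ∈ orderings y x, F l := by
    intro σ
    rw [← sum_stabSet_map F σ y x]
    exact Finset.sum_congr rfl fun τ hτ => by rw [combOrder_mul (mem_stabSet.1 hτ)]
  simp only [h2, Finset.sum_const, Finset.card_univ, card_perm_fin, nsmul_eq_mul]

/-- [folklore] **THE S_d-SUM OF S1 IS `d!∕m!` TIMES THE SUM OVER B12's CONTOUR FAMILY**: `symAxial A y x · m! = d! · Σ_{l ∈ orderings y x} ΣA(stair_l)`, i.e.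
`(1∕d!)·symAxial A y x = |G(y,x)|⁻¹ Σ_{Γ∈G(y,x)} A(Γ)` with `|G(y,x)| = m!`. -/
theorem symAxial_mul_card (A : Form1 d ℝ) (y x : Site d) :
    symAxial A y x * ((movingAxes y x).card ! : ℝ) = (d ! : ℝ) * ∑ l ∈ orderings y x, (stairFrom l A y x).sum := by
  have h : symAxial A y x = ∑ σ : Equiv.Perm (Fin d), (fun l => (stairFrom l A y x).sum) (combOrder σ y x) := by
    simp only [symAxial, axialPerm_eq_stairFrom_sum]
  rw [h]
  exact sum_combOrder_mul_card (fun l => (stairFrom l A y x).sum) y x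

/-- [folklore] The normalised form: `(1∕d!)·symAxial A y x = (1∕m!)·Σ_{l ∈ orderings y x} ΣA(stair_l)`. -/
theorem symAxial_div (A : Form1 d ℝ) (y x : Site d) :
    symAxial A y x / (d ! : ℝ) = (∑ l ∈ orderings y x, (stairFrom l A y x).sum) / ((movingAxes y x).card ! : ℝ) := by
  have hd : (d ! : ℝ) ≠ 0 := Nat.cast_ne_zero.mpr (Nat.factorial_ne_zero d)
  have hm : ((movingAxes y x).card ! : ℝ) ≠ 0 := Nat.cast_ne_zero.mpr (Nat.factorial_ne_zero _)
  rw [div_eq_div_iff hd hm, symAxial_mul_card, mul_comm]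

end

end Summit.QuantumFields.BalabanUV.Beta.SymmetrisedContourCount
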